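import Summits.ABC.ABC.Theorems.EisensteinQuarantine.Negative.EisensteinQuarantineFalseOfForcedPairDegreeDepthLaw
import HarnessLib

/-!
# `EisensteinQuarantine` (stmt-ABC-15023, route ABC/DefiniteXi) is false under the η₂-depth law and a deep-2 Proth
# supply — the end of crux line `eta2-residuacity-depth`, landed as a negative lemma

Negative lemmas filed `--negative-modulo EtaTwoDepthLaw` by the lead (c3) of the crux chain (2026-08-17).  The second surviving
line of the crux, `Cruxes/EisensteinQuarantine/Lines/eta2_residuacity_depth.lean` (crux-plan seat, triage r2: 2/2 pass), refutes
the crux from two named halves — an ARITHMETIC half (`EtaTwoDepthLaw`: the 2-part of the quarantined congruence number of the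
Legendre–Proth Frey curve `E_(−p, p−1)` at `(N/p, p)` is at least `2^{m₂(p) − c}`, `m₂(p) = v₂[𝔽_p^× : ⟨2⟩]` the 2-power
residuacity depth of `2` modulo `p`; census 36/36 + 8/8 out of sample) and a SUPPLY half (`DeepTwoProthSupply`: primes
`p ≤ 2^{As}` with `2^s ∣ p − 1` and `s ≤ m₂(p)`, i.e. splitting completely in `ℚ(ζ_{2^s}, 2^{1/2^s})`; TRUE under ERH by
Lagarias–Odlyzko, unconditionally a least-prime-in-Chebotarev problem in degree `2^{2s−2}`) — through the landed
`EisensteinQuarantine_false_of_ProthDepthFamily` (p107816).  That composition was sorry-free in the line file (a crux workfile,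
not importable); this file puts it under `Theorems/…/Negative/` so that both halves become construction items of the ledger, and
adds the DEGREE-side form of the arithmetic half with its Takahashi transfer (p135429):

* `twoDepth p = v₂((p − 1) / ord_p 2)` and `le_twoDepth_of_pow_eq_one` (`2^s ∣ p−1 ∧ 2^{(p−1)/2^s} = 1 ⟹ s ≤ m₂(p)`, the exact
  target a supply prover must hit) — verbatim from the line file;
* `EtaTwoDepthLaw`, `DeepTwoProthSupply` (hypotheses; census-backed / ERH-true, NOT proved);
* `prothDepthFamily_of_etaTwoDepthLaw` and `EisensteinQuarantine_false_of_EtaTwoDepthLaw : EtaTwoDepthLaw → DeepTwoProthSupply → ¬EQ`;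
* `EtaTwoDegreeDepthLaw` (optimal modular degrees: `2^{m₂(p)} · ordProj[2] c_p(W_opt) ≤ 2^c · ordProj[2] δ_opt`, PARI/LMFDB-checkable;
  census kit j020843: `class-min v₂ deg − 3 − m₂ = 2, 4, 8, 6, 4, 9, 7, 5` on 8 fresh rows), `etaTwoDepthLaw_of_degreeDepthLaw`
  (via `pow_le_ordProj_brandtXi_of_degreeBound`, p135429: `takahashi2001_thm_2_3` + `FreyModularity`) and
  `EisensteinQuarantine_false_of_EtaTwoDegreeDepthLaw`.

## References

* [CalegariEmerton2005] F. Calegari, M. Emerton, On the ramification of Hecke algebras at Eisenstein primes, Invent. Math. 160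
  (2005), Prop. 3.17(ii).
* [Lecouturier2021] E. Lecouturier, Higher Eisenstein elements, congruences and modular degree (arXiv:1709.09114), §1, Thm. 1.5.
* [LagariasOdlyzko1977] J. Lagarias, A. Odlyzko, Effective versions of the Chebotarev density theorem (1977), Thm. 1.1 / Cor. 1.2.
* [Takahashi2001] S. Takahashi, J. Number Theory 90 (2001), Thm. 2.3 (p. 79).
-/

-- `Summit.<Summit>.<Problem>`: for the single-conjunct summit `ABC` the duplicate `ABC.ABC` is mandated.
set_option linter.dupNamespace false

noncomputable section

open scoped BigOperators
open Literature.NumberTheory.Automorphic Literature.NumberTheory.EllipticCurves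
open Literature.NumberTheory.EllipticCurves.ModularForms

namespace Summit.ABC.ABC.Theorems.EisensteinQuarantine.Negative

/-! ## The residuacity depth `m₂(p)` -/

/-- **The 2-power residuacity depth of 2 modulo `p`**: `m₂(p) := v₂[𝔽_p^× : ⟨2⟩] = v₂((p − 1) / ord_p 2)`; `2` is a
`2^m`-th power residue modulo the odd prime `p` iff `m ≤ m₂(p)` (`m₂(257) = 4`, `m₂(65537) = 11`, `m₂(3·2^s + 1) ≤ 2` for
`s ≤ 41`).  Junk (`p` not an odd prime) is never used. [cite: CalegariEmerton2005, Prop. 3.17(ii)] -/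
def twoDepth (p : ℕ) : ℕ := padicValNat 2 ((p - 1) / orderOf (2 : ZMod p))

/-- **Reduction target of the supply**: if `2^s ∣ p − 1` and `2^{(p−1)/2^s} = 1` in `ZMod p` (what a degree-one prime of
`ℚ(ζ_{2^s}, 2^{1/2^s})` above `p` delivers), then `s ≤ m₂(p)`: `ord_p 2 ∣ (p−1)/2^s`, so `2^s ∣ (p−1)/ord_p 2 ≠ 0`
(verbatim from the line file `Lines/eta2_residuacity_depth.lean`). [folklore] -/
theorem le_twoDepth_of_pow_eq_one {p s : ℕ} (hp : p.Prime) (hs : 2 ^ s ∣ p - 1)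
    (h : (2 : ZMod p) ^ ((p - 1) / 2 ^ s) = 1) : s ≤ twoDepth p := by
  haveI := Fact.mk hp
  have hp1 : p - 1 ≠ 0 := by have := hp.two_le; omega
  set r := orderOf (2 : ZMod p) with hr
  have hr_dvd : r ∣ (p - 1) / 2 ^ s := orderOf_dvd_of_pow_eq_one h
  obtain ⟨u, hu⟩ := hr_dvd
  obtain ⟨m, hm⟩ := hs
  have h2s : 0 < 2 ^ s := pow_pos two_pos s
  have hm' : m = r * u := by
    have : (p - 1) / 2 ^ s = m := by rw [hm, Nat.mul_div_cancel_left _ h2s]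
    rw [← this, hu]
  have hr0 : r ≠ 0 := by
    rintro h0
    rw [h0, zero_mul] at hm'
    rw [hm', mul_zero] at hm
    exact hp1 hm
  have hdiv : (p - 1) / r = 2 ^ s * u := by
    rw [hm, hm', show 2 ^ s * (r * u) = r * (2 ^ s * u) by ring,
      Nat.mul_div_cancel_left _ (Nat.pos_of_ne_zero hr0)]
  have hne : (p - 1) / r ≠ 0 := by
    rw [hdiv]
    refine Nat.mul_ne_zero (pow_ne_zero _ two_ne_zero) ?_
    rintro rfl
    rw [hm', mul_zero] at hm
    simp at hm
    exact hp1 hm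
  rw [twoDepth, ← hr]
  exact (padicValNat_dvd_iff_le hne).mp ⟨u, hdiv⟩

/-! ## The two halves of line `eta2-residuacity-depth` -/

/-- **Hypothesis `EtaTwoDepthLaw` — the η₂-depth law (census-backed, NOT proved, NOT in print).**  There is `c` such that for
every prime `p ≡ 1 (mod 32)`, with `E = E_(−p, p−1)` of conductor `N`: `2^{m₂(p)} ≤ 2^c · ordProj[2] ξ(E; N/p, p)`,
`ξ = brandtXi (N/p) p (a(E))`.  Mechanism (card `Ideas/eta2-residuacity-depth.md`): Mazur's `η₂ = T₂ − 3` acts on the higher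
Eisenstein elements of the level-`p` cluster through `log √2 ∈ (ℤ/p)^× ⊗ ℤ₂`, of valuation `m₂(p) − 1` (Calegari–Emerton
Prop. 3.17(ii); Lecouturier Thm. 1.5), and the Frey line (`U₂ = +1`) meets the ordinary old line to that depth.  Census: direct
Brandt `v₂ ξ(N/p, p) ≥ m₂(p) + 3` on 36/36 levels (equality at the Fermat primes 257, 65537).  It forces the eigen-line on its family
(as every lower bound on `ξ` does).  HYPOTHESIS of this negative lemma (filed `--negative-modulo EtaTwoDepthLaw`); not a Literature fact. -/
def EtaTwoDepthLaw : Prop :=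
  ∃ c : ℕ, ∀ p : ℕ, p.Prime → 2 ^ 5 ∣ p - 1 →
    ∀ N : ℕ, (freyCurve (-(p : ℤ)) ((p - 1 : ℕ) : ℤ)).conductorNorm ℤ = N →
      2 ^ twoDepth p ≤ 2 ^ c *
        ordProj[2] (brandtXi (N / p) p (fun n => (freyCurve (-(p : ℤ)) ((p - 1 : ℕ) : ℤ)).LFunction n))

/-- **Hypothesis `DeepTwoProthSupply` — deep-2 Proth primes of polynomial height (TRUE under ERH, open unconditionally).**  For
some `A` there are arbitrarily large `s` and primes `p ≤ 2^{A s}` with `2^s ∣ p − 1` and `s ≤ m₂(p)` — i.e. `p` splits completely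
in `K_s = ℚ(ζ_{2^s}, 2^{1/2^s})`.  Under ERH with `A = 5` (Lagarias–Odlyzko / Bach–Sorenson: least split prime
`≤ (4 log d_K + 2.5 n_K + 5)²`, Lagarias–Odlyzko 1977 Thm. 1.1 / Cor. 1.2; `log d_{K_s} ≍ s·4^s`); every unconditional bound is
`2^{O(s·4^s)}`.  HYPOTHESIS of this negative lemma (unconditionally OPEN, hence deliberately NOT a cited Literature fact). -/
def DeepTwoProthSupply : Prop :=
  ∃ A : ℕ, ∀ s₀ : ℕ, ∃ s p : ℕ, s₀ ≤ s ∧ p.Prime ∧ 2 ^ s ∣ p - 1 ∧ p ≤ 2 ^ (A * s) ∧ s ≤ twoDepth p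

/-- **Law ∧ supply ⟹ `ProthDepthFamily`** (the hypothesis of the landed p107816): take the deep-2 Proth primes of the supply with
`s ≥ 5` and bound `2^s ≤ 2^{m₂(p)} ≤ 2^c · ordProj[2] ξ` by the law (verbatim the line file's `prothDepthFamily_of_etaTwo`). [folklore] -/
theorem prothDepthFamily_of_etaTwoDepthLaw (hlaw : EtaTwoDepthLaw) (hsup : DeepTwoProthSupply) : ProthDepthFamily := by
  obtain ⟨c, hc⟩ := hlaw
  obtain ⟨A, hA⟩ := hsup
  refine ⟨c, A, fun s₀ => ?_⟩
  obtain ⟨s, p, hs, hp, hsp, hpA, hdepth⟩ := hA (max s₀ 5)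
  have hs5 : 5 ≤ s := le_of_max_le_right hs
  have h32 : 2 ^ 5 ∣ p - 1 := (Nat.pow_dvd_pow 2 hs5).trans hsp
  refine ⟨s, p, le_of_max_le_left hs, hp, hsp, hpA, fun N hN => ?_⟩
  calc 2 ^ s ≤ 2 ^ twoDepth p := Nat.pow_le_pow_right two_pos hdepth
    _ ≤ _ := hc p hp h32 N hN

/-- **`EisensteinQuarantine` is false under the η₂-depth law and the deep-2 Proth supply** — the end of crux line
`eta2-residuacity-depth`, through `EisensteinQuarantine_false_of_ProthDepthFamily` (p107816).  With the supply discharged from ERH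
(the line's `stub_deepTwoSupply_of_erh`, not proved in the tree) this reads `ERH → EtaTwoDepthLaw → ¬EQ`. [folklore] -/
theorem EisensteinQuarantine_false_of_EtaTwoDepthLaw (hlaw : EtaTwoDepthLaw) (hsup : DeepTwoProthSupply) :
    ¬ Summit.ABC.ABC.Theses.DefiniteXi.EisensteinQuarantine :=
  EisensteinQuarantine_false_of_ProthDepthFamily (prothDepthFamily_of_etaTwoDepthLaw hlaw hsup)

/-! ## The arithmetic half on the DEGREE side -/

/-- **Hypothesis `EtaTwoDegreeDepthLaw` — the η₂-depth law for OPTIMAL MODULAR DEGREES (census-backed, NOT proved).**  There is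
`c` such that for every prime `p ≡ 1 (mod 32)`, `E = E_(−p, p−1)` of conductor `N`, every elliptic `W/ℚ` with `aₙ(W) = aₙ(E)`
for all `n` and every datum `P` of `W` at level `N` that is degree-minimal in its newform class:
`2^{m₂(p)} · ordProj[2] c_p(W) ≤ 2^c · ordProj[2] δ(P)` — `v₂(δ_opt) − v₂(c_p(W_opt)) ≥ m₂(p) − c`.  This is the form the line's
out-of-sample census measured (kit j020814/j020843, PARI `ellmoddegree` over isogeny classes: 8/8 rows at `c = 0` with ≥ 2 bits to
spare; 36-row table: `d ≥ m₂ + 3`).  It implies `EtaTwoDepthLaw` (`etaTwoDepthLaw_of_degreeDepthLaw`, via Takahashi's Thm. 2.3).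
HYPOTHESIS of this negative lemma; not a Literature fact. -/
def EtaTwoDegreeDepthLaw : Prop :=
  ∃ c : ℕ, ∀ p : ℕ, p.Prime → 2 ^ 5 ∣ p - 1 →
    ∀ (N : ℕ) [NeZero N], (freyCurve (-(p : ℤ)) ((p - 1 : ℕ) : ℤ)).conductorNorm ℤ = N →
    ∀ (W : WeierstrassCurve ℚ) [W.IsElliptic] (P : ModularParametrizationData W N),
      (∀ n : ℕ, W.LFunction n = (freyCurve (-(p : ℤ)) ((p - 1 : ℕ) : ℤ)).LFunction n) →
      (∀ (W' : WeierstrassCurve ℚ) [W'.IsElliptic] (P' : ModularParametrizationData W' N),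
          P'.f = P.f → P.modularDegree ≤ P'.modularDegree) →
      2 ^ twoDepth p * ordProj[2] ((W.minimalDiscriminantNorm ℤ).factorization p) ≤
        2 ^ c * ordProj[2] P.modularDegree

/-- **`EtaTwoDegreeDepthLaw` ⟹ `EtaTwoDepthLaw`** (same `c`), by the Takahashi transfer
`pow_le_ordProj_brandtXi_of_degreeBound` (p135429) at every `p ≡ 1 (mod 32)`, the law being applied at the level `N / p · p = N`.
[cite: Takahashi2001, Thm. 2.3 (p. 79)] -/
theorem etaTwoDepthLaw_of_degreeDepthLaw (hT : takahashi2001_thm_2_3)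
    (hMod : Summit.ABC.ABC.Theses.DefiniteXi.FreyModularity) (hD : EtaTwoDegreeDepthLaw) : EtaTwoDepthLaw := by
  obtain ⟨c, hc⟩ := hD
  refine ⟨c, fun p hp h32 N hN => ?_⟩
  have h32' : 32 ∣ p - 1 := by norm_num at h32; exact h32
  have hN' : (freyCurve (-(p : ℤ)) ((p - 1 : ℕ) : ℤ)).conductorNorm ℤ = N / p * p := by
    rw [Nat.div_mul_cancel (dvd_conductorNorm_of_legendrePoint hp h32' hN)]; exact hN
  refine pow_le_ordProj_brandtXi_of_degreeBound hT hMod hp h32' hN ?_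
  intro _ W _ P hLf hmin
  exact hc p hp h32 (N / p * p) hN' W P hLf hmin

/-- **`EisensteinQuarantine` is false under Takahashi's Thm. 2.3, modularity of Frey curves, the η₂-DEGREE depth law and the
deep-2 Proth supply** (`etaTwoDepthLaw_of_degreeDepthLaw`, then `EisensteinQuarantine_false_of_EtaTwoDepthLaw`).
[cite: Takahashi2001, Thm. 2.3 (p. 79)] -/
theorem EisensteinQuarantine_false_of_EtaTwoDegreeDepthLaw (hT : takahashi2001_thm_2_3)
    (hMod : Summit.ABC.ABC.Theses.DefiniteXi.FreyModularity) (hD : EtaTwoDegreeDepthLaw) (hsup : DeepTwoProthSupply) :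
    ¬ Summit.ABC.ABC.Theses.DefiniteXi.EisensteinQuarantine :=
  EisensteinQuarantine_false_of_EtaTwoDepthLaw (etaTwoDepthLaw_of_degreeDepthLaw hT hMod hD) hsup

end Summit.ABC.ABC.Theorems.EisensteinQuarantine.Negative

end
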